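import Literature.NumberTheory.Sieve.DrappeauDispersionR1ppTerms
import HarnessLib

/-!
# Drappeau 2017, §5.5: the inner sums of `ℛ₁''` and of Theorem 2.1 agree; vanishing off range

Topic `Literature/NumberTheory/Sieve`, part of the formalisation of §5 of S. Drappeau, Proc. London
Math. Soc. (3) 114 (2017) 684–732 = arXiv:1504.05549, p. 20–21.  Summing the termwise
identifications of `DrappeauDispersionR1ppTerms` over `(n₁, n₂, h)` and recording the facts about
the index sets of the tree's `ℛ₁''` that are needed to reconcile the ranges of `𝐜, 𝐝` (the moduli
sets of `ℛ₁''` versus the boxes `[1, 2C] × [1, 2D]` of Theorem 2.1: a term can only be non-zero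
when the weight is, and then the modulus lies in the range of `ℛ₁''`).  Everything proved, no
definition, no named fact.

* `mem_moduliImage`, `moduliImage_mem` — membership in the sets `{q/δ : q ∈ A ∩ cls, δ ∣ q}`;
* `mem_Bset` — membership in the set of reduced `n`'s;
* `inner_match_pos`, `inner_match_neg` — `∑_{n₁,n₂,h}` of the termwise identities;
* `collInner_eq_zero_of_weight`, `collInner_eq_zero_of_class` — vanishing of the inner sums of the
  collapsed left-hand side.

## References

* S. Drappeau, Proc. London Math. Soc. (3) 114 (2017) 684–732, arXiv:1504.05549, §5.5 p. 20–21.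
  [cite: Drappeau2017, §5.5]
-/

noncomputable section

open Finset Real Complex
open scoped ArithmeticFunction.Moebius FourierTransform

namespace Literature.NumberTheory.Sieve

namespace Drappeau2017

/-! ### The index sets -/

/-- Elements of `{q/δ : q ∈ A⁰, q % m = l, δ ∣ q}` (`A⁰` the reduced moduli of `ℛ₁''`): `c > 0`
and `(δc) % m = l`. [folklore] -/
theorem mem_moduliImage {S Y : ℝ} {q₀ : ℕ} (hq₀ : 0 < q₀) {a₂ : ℤ} {m l δ c : ℕ} (hδ : 0 < δ)
    (hc : c ∈ (((((((BFI.mRange S Y).filter (fun q : ℕ => 0 < q)).filter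
        (fun q : ℕ => IsCoprime (q : ℤ) a₂)).filter (fun q : ℕ => q₀ ∣ q)).image
        (fun q : ℕ => q / q₀)).filter (fun q : ℕ => q % m = l)).filter (fun q : ℕ => δ ∣ q)).image
        (fun q : ℕ => q / δ)) :
    0 < c ∧ (δ * c) % m = l := by
  simp only [Finset.mem_image, Finset.mem_filter] at hc
  obtain ⟨q', ⟨⟨⟨q, ⟨⟨⟨_, hq0⟩, _⟩, hdvd⟩, rfl⟩, hcls⟩, hδq⟩, rfl⟩ := hc
  rw [Nat.mul_div_cancel' hδq]
  refine ⟨?_, hcls⟩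
  obtain ⟨k, hk⟩ := hδq
  have hpos : 0 < q / q₀ := Nat.div_pos (Nat.le_of_dvd hq0 hdvd) hq₀
  rw [hk] at hpos ⊢
  rw [Nat.mul_div_cancel_left _ hδ]
  exact Nat.pos_of_ne_zero fun h0 => by rw [h0, mul_zero] at hpos; exact lt_irrefl _ hpos

/-- Conversely: `c > 0`, `(δc) % m = l`, `q₀δc ∈ mRange`, `(q₀δc, a₂) = 1` put `c` in the set.
[folklore] -/
theorem moduliImage_mem {S Y : ℝ} {q₀ : ℕ} (hq₀ : 0 < q₀) {a₂ : ℤ} {m l δ c : ℕ} (hδ : 0 < δ)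
    (hc : 0 < c) (hcls : (δ * c) % m = l) (hR : q₀ * (δ * c) ∈ BFI.mRange S Y)
    (hcop : IsCoprime ((q₀ * (δ * c) : ℕ) : ℤ) a₂) :
    c ∈ (((((((BFI.mRange S Y).filter (fun q : ℕ => 0 < q)).filter
        (fun q : ℕ => IsCoprime (q : ℤ) a₂)).filter (fun q : ℕ => q₀ ∣ q)).image
        (fun q : ℕ => q / q₀)).filter (fun q : ℕ => q % m = l)).filter (fun q : ℕ => δ ∣ q)).image
        (fun q : ℕ => q / δ) := by
  simp only [Finset.mem_image, Finset.mem_filter]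
  refine ⟨δ * c, ⟨⟨⟨q₀ * (δ * c), ⟨⟨⟨hR, by positivity⟩, hcop⟩, Dvd.intro _ rfl⟩, ?_⟩, hcls⟩,
    Dvd.intro _ rfl⟩, ?_⟩
  · rw [Nat.mul_div_cancel_left _ hq₀]
  · rw [Nat.mul_div_cancel_left _ hδ]

/-- Elements of the set of reduced `n`'s: `n > 0`, `(n₀n, a₂) = 1` and `n₀n ∈ (N, 2N]`.
[folklore] -/
theorem mem_Bset {N : ℝ} (hN : 0 ≤ N) {a₂ : ℤ} {n₀ n : ℕ} (hn₀ : 0 < n₀)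
    (hn : n ∈ (((BFI.dyadic N).filter (fun n : ℕ => IsCoprime (n : ℤ) a₂)).filter
        (fun n : ℕ => n₀ ∣ n)).image (fun n : ℕ => n / n₀)) :
    0 < n ∧ Nat.Coprime (n₀ * n) a₂.natAbs ∧ n₀ * n ∈ BFI.dyadic N := by
  simp only [Finset.mem_image, Finset.mem_filter] at hn
  obtain ⟨n', ⟨⟨hd, hcop⟩, hdvd⟩, rfl⟩ := hn
  rw [Nat.mul_div_cancel' hdvd]
  have hpos : 0 < n' := by
    have := (BFI.mem_dyadic hN).1 hd
    exact_mod_cast lt_of_le_of_lt hN this.1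
  refine ⟨Nat.div_pos (Nat.le_of_dvd hpos hdvd) hn₀, (isCoprime_natCast_left_iff _ _).1 hcop, hd⟩

/-! ### The inner sums -/

section Inner

variable {a₁ a₂ : ℤ} {q₀ n₀ δ₁ δ₂ c d c₀ d₀ nlo nhi l₁ l₂ : ℕ} {β : ℕ → ℂ} {ξ : ℝ}
  {In Ir Is B : Finset ℕ} {G : ℕ → ℕ → ℂ} {g : ℝ → ℝ → ℝ → ℝ → ℝ → ℂ} {H : ℕ}

/-- **Inner sums, positive block.** [cite: Drappeau2017, §5.5 p. 20–21] -/
theorem inner_match_pos (ha₂ : a₂ ≠ 0) (hq₀n₀ : Nat.Coprime q₀ n₀)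
    (hδ₁m : Nat.Coprime δ₁ (a₂.natAbs * n₀)) (hδ₂m : Nat.Coprime δ₂ (a₂.natAbs * n₀))
    (hc : 0 < c) (hcm : Nat.Coprime c (a₂.natAbs * n₀)) (hdm : Nat.Coprime d (a₂.natAbs * n₀))
    (hcls : c ≡ c₀ [MOD a₂.natAbs * n₀] ∧ d ≡ d₀ [MOD a₂.natAbs * n₀])
    (hB : ∀ n ∈ B, 0 < n ∧ Nat.Coprime (n₀ * n) a₂.natAbs)
    (hβ : ∀ n, ¬Squarefree n → β n = 0) (hδ₂ : 0 < δ₂)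
    (hIn : ∀ z : ℤ, ((nlo : ℕ) : ℤ) ≤ z → z < ((nhi : ℕ) : ℤ) → z.toNat ∈ In)
    (hIr : ∀ n₂ ∈ B, a₂.natAbs * n₀ * δ₁ * n₂ ∈ Ir) (hIs : ∀ n₁ ∈ B, δ₂ * n₁ ∈ Is)
    (hGg : ∀ n₁ ∈ B, ∀ n₂ ∈ B, ∀ h : ℤ,
      ((nlo : ℕ) : ℤ) ≤ nVar 1 a₁ a₂ q₀ h n₁ n₂ → nVar 1 a₁ a₂ q₀ h n₁ n₂ < ((nhi : ℕ) : ℤ) →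
      G (δ₁ * d) (δ₂ * c) = g c d (nVar 1 a₁ a₂ q₀ h n₁ n₂).toNat ((a₂.natAbs * n₀ * δ₁ * n₂ : ℕ) : ℝ) ((δ₂ * n₁ : ℕ) : ℝ)) :
    ∑ n₁ ∈ B, ∑ n₂ ∈ B, ∑ h ∈ (Finset.Icc (-(H : ℤ)) H).filter (fun h : ℤ => h ≠ 0),
          (if ((Nat.Coprime (δ₁ * d) (δ₂ * c) ∧ Nat.Coprime n₁ n₂ ∧ ((n₀ * n₁).Coprime (q₀ * (δ₁ * d)) ∧ (n₀ * n₂).Coprime (q₀ * (δ₂ * c)) ∧ n₁ ≡ n₂ [MOD q₀])) ∧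
          (((nlo : ℕ) : ℤ) ≤ nVar 1 a₁ a₂ q₀ h n₁ n₂ ∧ nVar 1 a₁ a₂ q₀ h n₁ n₂ < ((nhi : ℕ) : ℤ))) then
            G (δ₁ * d) (δ₂ * c) * (β (n₀ * n₁) * starRingEnd ℂ (β (n₀ * n₂))) *
              ((𝐞 (-(ξ * h)) : ℂ) *
                ((𝐞 ((h : ℝ) * a₁ * ((((n₁ : ℤ) - n₂) / q₀ : ℤ)) *
                    (((((((δ₁ * d : ℕ) : ℤ) * a₂ * n₀ * n₂ : ℤ) : ZMod (n₁ * (δ₂ * c)))⁻¹).val : ℕ) : ℝ) /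
                      ((n₁ : ℝ) * ((δ₂ * c : ℕ) : ℝ))) : ℂ) *
                  (𝐞 (-((h : ℝ) * a₁ *
                    ((((((q₀ : ℤ) * l₁ * l₂ * n₁ : ℤ) : ZMod (a₂.natAbs * n₀))⁻¹).val : ℕ) : ℝ) /
                      ((a₂ : ℝ) * n₀))) : ℂ)))
      else 0) =
      ∑ n₁ ∈ B, ∑ n₂ ∈ B, ∑ h ∈ (Finset.Icc (-(H : ℤ)) H).filter (fun h : ℤ => h ≠ 0),
          (if (0 ≤ nVar 1 a₁ a₂ q₀ h n₁ n₂ ∧ (nVar 1 a₁ a₂ q₀ h n₁ n₂).toNat ∈ In ∧ (a₂.natAbs * n₀ * δ₁ * n₂) ∈ Ir ∧ (δ₂ * n₁) ∈ Is ∧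
          (c ≡ c₀ [MOD a₂.natAbs * n₀] ∧ d ≡ d₀ [MOD a₂.natAbs * n₀] ∧ Nat.Coprime (a₂.natAbs * n₀ * (a₂.natAbs * n₀ * δ₁ * n₂) * d) ((δ₂ * n₁) * c)) ∧
          (Nat.Coprime n₁ n₂ ∧ n₁ ≡ n₂ [MOD q₀] ∧ (n₀ * n₁).Coprime q₀ ∧ (n₀ * n₂).Coprime q₀ ∧
            ((nlo : ℕ) : ℤ) ≤ nVar 1 a₁ a₂ q₀ h n₁ n₂ ∧ nVar 1 a₁ a₂ q₀ h n₁ n₂ < ((nhi : ℕ) : ℤ))) then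
            (β (n₀ * n₁) * starRingEnd ℂ (β (n₀ * n₂)) *
              ((𝐞 (-(ξ * h)) : ℂ) *
                (𝐞 (-((h : ℝ) * a₁ *
                    ((((((q₀ : ℤ) * l₁ * l₂ * n₁ : ℤ) : ZMod (a₂.natAbs * n₀))⁻¹).val : ℕ) : ℝ) /
                      ((a₂ : ℝ) * n₀))) : ℂ))) *
            (g c d (nVar 1 a₁ a₂ q₀ h n₁ n₂).toNat ((a₂.natAbs * n₀ * δ₁ * n₂ : ℕ) : ℝ) ((δ₂ * n₁ : ℕ) : ℝ) *
              (𝐞 (((nVar 1 a₁ a₂ q₀ h n₁ n₂).toNat : ℝ) * (((((a₂.natAbs * n₀ * δ₁ * n₂) * d : ℕ) : ZMod ((δ₂ * n₁) * c))⁻¹).val : ℝ) /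
                (((δ₂ * n₁ : ℕ) : ℝ) * c)) : ℂ))
          else 0) := by
  refine Finset.sum_congr rfl fun n₁ hn₁ => Finset.sum_congr rfl fun n₂ hn₂ =>
    Finset.sum_congr rfl fun h _ => ?_
  exact term_match_pos ha₂ hq₀n₀ hδ₁m hδ₂m hc hcm hdm hcls (hB n₁ hn₁).1 (hB n₁ hn₁).2 hβ h hδ₂
    hIn (hIr n₂ hn₂) (hIs n₁ hn₁) (hGg n₁ hn₁ n₂ hn₂ h)

/-- **Inner sums, negative block** (conjugated). [cite: Drappeau2017, §5.5 p. 20–21] -/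
theorem inner_match_neg (ha₂ : a₂ ≠ 0) (hq₀n₀ : Nat.Coprime q₀ n₀)
    (hδ₁m : Nat.Coprime δ₁ (a₂.natAbs * n₀)) (hδ₂m : Nat.Coprime δ₂ (a₂.natAbs * n₀))
    (hc : 0 < c) (hcm : Nat.Coprime c (a₂.natAbs * n₀)) (hdm : Nat.Coprime d (a₂.natAbs * n₀))
    (hcls : c ≡ c₀ [MOD a₂.natAbs * n₀] ∧ d ≡ d₀ [MOD a₂.natAbs * n₀])
    (hB : ∀ n ∈ B, 0 < n ∧ Nat.Coprime (n₀ * n) a₂.natAbs)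
    (hβ : ∀ n, ¬Squarefree n → β n = 0) (hδ₂ : 0 < δ₂)
    (hIn : ∀ z : ℤ, ((nlo : ℕ) : ℤ) ≤ z → z < ((nhi : ℕ) : ℤ) → z.toNat ∈ In)
    (hIr : ∀ n₂ ∈ B, a₂.natAbs * n₀ * δ₁ * n₂ ∈ Ir) (hIs : ∀ n₁ ∈ B, δ₂ * n₁ ∈ Is)
    (hGreal : starRingEnd ℂ (G (δ₁ * d) (δ₂ * c)) = G (δ₁ * d) (δ₂ * c))
    (hGg : ∀ n₁ ∈ B, ∀ n₂ ∈ B, ∀ h : ℤ,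
      ((nlo : ℕ) : ℤ) ≤ nVar (-1) a₁ a₂ q₀ h n₁ n₂ → nVar (-1) a₁ a₂ q₀ h n₁ n₂ < ((nhi : ℕ) : ℤ) →
      G (δ₁ * d) (δ₂ * c) = g c d (nVar (-1) a₁ a₂ q₀ h n₁ n₂).toNat ((a₂.natAbs * n₀ * δ₁ * n₂ : ℕ) : ℝ) ((δ₂ * n₁ : ℕ) : ℝ)) :
    starRingEnd ℂ (∑ n₁ ∈ B, ∑ n₂ ∈ B, ∑ h ∈ (Finset.Icc (-(H : ℤ)) H).filter (fun h : ℤ => h ≠ 0),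
          (if ((Nat.Coprime (δ₁ * d) (δ₂ * c) ∧ Nat.Coprime n₁ n₂ ∧ ((n₀ * n₁).Coprime (q₀ * (δ₁ * d)) ∧ (n₀ * n₂).Coprime (q₀ * (δ₂ * c)) ∧ n₁ ≡ n₂ [MOD q₀])) ∧
          (((nlo : ℕ) : ℤ) ≤ nVar (-1) a₁ a₂ q₀ h n₁ n₂ ∧ nVar (-1) a₁ a₂ q₀ h n₁ n₂ < ((nhi : ℕ) : ℤ))) then
            G (δ₁ * d) (δ₂ * c) * (β (n₀ * n₁) * starRingEnd ℂ (β (n₀ * n₂))) *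
              ((𝐞 (-(ξ * h)) : ℂ) *
                ((𝐞 ((h : ℝ) * a₁ * ((((n₁ : ℤ) - n₂) / q₀ : ℤ)) *
                    (((((((δ₁ * d : ℕ) : ℤ) * a₂ * n₀ * n₂ : ℤ) : ZMod (n₁ * (δ₂ * c)))⁻¹).val : ℕ) : ℝ) /
                      ((n₁ : ℝ) * ((δ₂ * c : ℕ) : ℝ))) : ℂ) *
                  (𝐞 (-((h : ℝ) * a₁ *
                    ((((((q₀ : ℤ) * l₁ * l₂ * n₁ : ℤ) : ZMod (a₂.natAbs * n₀))⁻¹).val : ℕ) : ℝ) /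
                      ((a₂ : ℝ) * n₀))) : ℂ)))
      else 0)) =
      ∑ n₁ ∈ B, ∑ n₂ ∈ B, ∑ h ∈ (Finset.Icc (-(H : ℤ)) H).filter (fun h : ℤ => h ≠ 0),
          (if (0 ≤ nVar (-1) a₁ a₂ q₀ h n₁ n₂ ∧ (nVar (-1) a₁ a₂ q₀ h n₁ n₂).toNat ∈ In ∧ (a₂.natAbs * n₀ * δ₁ * n₂) ∈ Ir ∧ (δ₂ * n₁) ∈ Is ∧
          (c ≡ c₀ [MOD a₂.natAbs * n₀] ∧ d ≡ d₀ [MOD a₂.natAbs * n₀] ∧ Nat.Coprime (a₂.natAbs * n₀ * (a₂.natAbs * n₀ * δ₁ * n₂) * d) ((δ₂ * n₁) * c)) ∧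
          (Nat.Coprime n₁ n₂ ∧ n₁ ≡ n₂ [MOD q₀] ∧ (n₀ * n₁).Coprime q₀ ∧ (n₀ * n₂).Coprime q₀ ∧
            ((nlo : ℕ) : ℤ) ≤ nVar (-1) a₁ a₂ q₀ h n₁ n₂ ∧ nVar (-1) a₁ a₂ q₀ h n₁ n₂ < ((nhi : ℕ) : ℤ))) then
            starRingEnd ℂ (β (n₀ * n₁) * starRingEnd ℂ (β (n₀ * n₂)) *
              ((𝐞 (-(ξ * h)) : ℂ) *
                (𝐞 (-((h : ℝ) * a₁ *
                    ((((((q₀ : ℤ) * l₁ * l₂ * n₁ : ℤ) : ZMod (a₂.natAbs * n₀))⁻¹).val : ℕ) : ℝ) /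
                      ((a₂ : ℝ) * n₀))) : ℂ))) *
            (g c d (nVar (-1) a₁ a₂ q₀ h n₁ n₂).toNat ((a₂.natAbs * n₀ * δ₁ * n₂ : ℕ) : ℝ) ((δ₂ * n₁ : ℕ) : ℝ) *
              (𝐞 (((nVar (-1) a₁ a₂ q₀ h n₁ n₂).toNat : ℝ) * (((((a₂.natAbs * n₀ * δ₁ * n₂) * d : ℕ) : ZMod ((δ₂ * n₁) * c))⁻¹).val : ℝ) /
                (((δ₂ * n₁ : ℕ) : ℝ) * c)) : ℂ))
          else 0) := by
  rw [map_sum]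
  refine Finset.sum_congr rfl fun n₁ hn₁ => ?_
  rw [map_sum]
  refine Finset.sum_congr rfl fun n₂ hn₂ => ?_
  rw [map_sum]
  refine Finset.sum_congr rfl fun h _ => ?_
  exact term_match_neg ha₂ hq₀n₀ hδ₁m hδ₂m hc hcm hdm hcls (hB n₁ hn₁).1 (hB n₁ hn₁).2 hβ h hδ₂
    hIn (hIr n₂ hn₂) (hIs n₁ hn₁) hGreal (hGg n₁ hn₁ n₂ hn₂ h)

/-- **Vanishing of the collapsed inner sum when the weight vanishes at `(𝐜, 𝐝)`** (any value
function `V`). [folklore] -/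
theorem collInner_eq_zero_of_weight (σ : ℤ) (V : ℤ → ℕ → ℕ → ℂ)
    (hg : ∀ n r s : ℝ, g c d n r s = 0) :
    ∑ n₁ ∈ B, ∑ n₂ ∈ B, ∑ h ∈ (Finset.Icc (-(H : ℤ)) H).filter (fun h : ℤ => h ≠ 0),
          (if (0 ≤ nVar σ a₁ a₂ q₀ h n₁ n₂ ∧ (nVar σ a₁ a₂ q₀ h n₁ n₂).toNat ∈ In ∧ (a₂.natAbs * n₀ * δ₁ * n₂) ∈ Ir ∧ (δ₂ * n₁) ∈ Is ∧
          (c ≡ c₀ [MOD a₂.natAbs * n₀] ∧ d ≡ d₀ [MOD a₂.natAbs * n₀] ∧ Nat.Coprime (a₂.natAbs * n₀ * (a₂.natAbs * n₀ * δ₁ * n₂) * d) ((δ₂ * n₁) * c)) ∧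
          (Nat.Coprime n₁ n₂ ∧ n₁ ≡ n₂ [MOD q₀] ∧ (n₀ * n₁).Coprime q₀ ∧ (n₀ * n₂).Coprime q₀ ∧
            ((nlo : ℕ) : ℤ) ≤ nVar σ a₁ a₂ q₀ h n₁ n₂ ∧ nVar σ a₁ a₂ q₀ h n₁ n₂ < ((nhi : ℕ) : ℤ))) then
            V h n₁ n₂ *
            (g c d (nVar σ a₁ a₂ q₀ h n₁ n₂).toNat ((a₂.natAbs * n₀ * δ₁ * n₂ : ℕ) : ℝ) ((δ₂ * n₁ : ℕ) : ℝ) *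
              (𝐞 (((nVar σ a₁ a₂ q₀ h n₁ n₂).toNat : ℝ) * (((((a₂.natAbs * n₀ * δ₁ * n₂) * d : ℕ) : ZMod ((δ₂ * n₁) * c))⁻¹).val : ℝ) /
                (((δ₂ * n₁ : ℕ) : ℝ) * c)) : ℂ))
          else 0) = 0 := by
  refine Finset.sum_eq_zero fun n₁ _ => Finset.sum_eq_zero fun n₂ _ =>
    Finset.sum_eq_zero fun h _ => ?_
  split_ifs
  · rw [hg, zero_mul, mul_zero]
  · rfl

/-- **Vanishing of the collapsed inner sum off the classes.** [folklore] -/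
theorem collInner_eq_zero_of_class (σ : ℤ) (V : ℤ → ℕ → ℕ → ℂ)
    (hcls : ¬ (c ≡ c₀ [MOD a₂.natAbs * n₀] ∧ d ≡ d₀ [MOD a₂.natAbs * n₀])) :
    ∑ n₁ ∈ B, ∑ n₂ ∈ B, ∑ h ∈ (Finset.Icc (-(H : ℤ)) H).filter (fun h : ℤ => h ≠ 0),
          (if (0 ≤ nVar σ a₁ a₂ q₀ h n₁ n₂ ∧ (nVar σ a₁ a₂ q₀ h n₁ n₂).toNat ∈ In ∧ (a₂.natAbs * n₀ * δ₁ * n₂) ∈ Ir ∧ (δ₂ * n₁) ∈ Is ∧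
          (c ≡ c₀ [MOD a₂.natAbs * n₀] ∧ d ≡ d₀ [MOD a₂.natAbs * n₀] ∧ Nat.Coprime (a₂.natAbs * n₀ * (a₂.natAbs * n₀ * δ₁ * n₂) * d) ((δ₂ * n₁) * c)) ∧
          (Nat.Coprime n₁ n₂ ∧ n₁ ≡ n₂ [MOD q₀] ∧ (n₀ * n₁).Coprime q₀ ∧ (n₀ * n₂).Coprime q₀ ∧
            ((nlo : ℕ) : ℤ) ≤ nVar σ a₁ a₂ q₀ h n₁ n₂ ∧ nVar σ a₁ a₂ q₀ h n₁ n₂ < ((nhi : ℕ) : ℤ))) then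
            V h n₁ n₂ *
            (g c d (nVar σ a₁ a₂ q₀ h n₁ n₂).toNat ((a₂.natAbs * n₀ * δ₁ * n₂ : ℕ) : ℝ) ((δ₂ * n₁ : ℕ) : ℝ) *
              (𝐞 (((nVar σ a₁ a₂ q₀ h n₁ n₂).toNat : ℝ) * (((((a₂.natAbs * n₀ * δ₁ * n₂) * d : ℕ) : ZMod ((δ₂ * n₁) * c))⁻¹).val : ℝ) /
                (((δ₂ * n₁ : ℕ) : ℝ) * c)) : ℂ))
          else 0) = 0 := by
  refine Finset.sum_eq_zero fun n₁ _ => Finset.sum_eq_zero fun n₂ _ =>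
    Finset.sum_eq_zero fun h _ => ?_
  rw [if_neg]
  exact fun h' => hcls ⟨h'.2.2.2.2.1.1, h'.2.2.2.2.1.2.1⟩

/-- **A non-vanishing collapsed inner sum has a non-vanishing weight at a point of the classes.**
[folklore] -/
theorem exists_of_collInner_ne_zero (σ : ℤ) (V : ℤ → ℕ → ℕ → ℂ)
    (h : ∑ n₁ ∈ B, ∑ n₂ ∈ B, ∑ h ∈ (Finset.Icc (-(H : ℤ)) H).filter (fun h : ℤ => h ≠ 0),
          (if (0 ≤ nVar σ a₁ a₂ q₀ h n₁ n₂ ∧ (nVar σ a₁ a₂ q₀ h n₁ n₂).toNat ∈ In ∧ (a₂.natAbs * n₀ * δ₁ * n₂) ∈ Ir ∧ (δ₂ * n₁) ∈ Is ∧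
          (c ≡ c₀ [MOD a₂.natAbs * n₀] ∧ d ≡ d₀ [MOD a₂.natAbs * n₀] ∧ Nat.Coprime (a₂.natAbs * n₀ * (a₂.natAbs * n₀ * δ₁ * n₂) * d) ((δ₂ * n₁) * c)) ∧
          (Nat.Coprime n₁ n₂ ∧ n₁ ≡ n₂ [MOD q₀] ∧ (n₀ * n₁).Coprime q₀ ∧ (n₀ * n₂).Coprime q₀ ∧
            ((nlo : ℕ) : ℤ) ≤ nVar σ a₁ a₂ q₀ h n₁ n₂ ∧ nVar σ a₁ a₂ q₀ h n₁ n₂ < ((nhi : ℕ) : ℤ))) then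
            V h n₁ n₂ *
            (g c d (nVar σ a₁ a₂ q₀ h n₁ n₂).toNat ((a₂.natAbs * n₀ * δ₁ * n₂ : ℕ) : ℝ) ((δ₂ * n₁ : ℕ) : ℝ) *
              (𝐞 (((nVar σ a₁ a₂ q₀ h n₁ n₂).toNat : ℝ) * (((((a₂.natAbs * n₀ * δ₁ * n₂) * d : ℕ) : ZMod ((δ₂ * n₁) * c))⁻¹).val : ℝ) /
                (((δ₂ * n₁ : ℕ) : ℝ) * c)) : ℂ))
          else 0) ≠ 0) :
    (c ≡ c₀ [MOD a₂.natAbs * n₀] ∧ d ≡ d₀ [MOD a₂.natAbs * n₀]) ∧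
      ∃ n r s : ℝ, g c d n r s ≠ 0 := by
  by_contra hneg
  apply h
  by_cases hcls : (c ≡ c₀ [MOD a₂.natAbs * n₀] ∧ d ≡ d₀ [MOD a₂.natAbs * n₀])
  · refine collInner_eq_zero_of_weight σ V fun n r s => ?_
    by_contra hg
    exact hneg ⟨hcls, n, r, s, hg⟩
  · exact collInner_eq_zero_of_class σ V hcls

end Inner

end Drappeau2017

end Literature.NumberTheory.Sieve

end
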